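import Summits.AtomisticToContinuum.Crystallization.Theorems.ChargedEnergyGap.Negative.BlocksBound

/-!
# Uniform binding rigidity — a uniformly `2E*`-bound periodic configuration is a minimiser

Crux item `stmt-AtomisticToContinuum-15099`
(`Summit.AtomisticToContinuum.Crystallization.Theses.PerronTransitivity.UniformBindingRigidity`),
line `registered`, stub `stub_periodicLeast`.

A periodic configuration `P` of `ℝ³` every site `p` of which has Lennard-Jones site energy
`U_P(p) = ∑'_{q ∈ P.points, q ≠ p} V_LJ(dist p q) ≤ 2E*`, where `E* = ⨅_Q e_LJ(Q)` is the infimum of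
the energy per particle over periodic configurations, is a least element of the range of `e_LJ`:
averaging over the motif `F` gives `e(P) = (2·#F)⁻¹ ∑_{x ∈ F} U_P(x) ≤ (2·#F)⁻¹ · #F · 2E* = E*`,
and `E* ≤ e(Q)` for every periodic `Q` because the range is bounded below
(item 0714, `ChargedEnergyGapNegative.bddBelow_energyPerParticle_lennardJones` / `eStar_le`).
All `[folklore]`.
-/

noncomputable section

namespace Summit.AtomisticToContinuum.Crystallization.Theorems.PerronTransitivityUniformBindingRigidity

open Literature.MathematicalPhysics.StatisticalMechanics
open Summit.AtomisticToContinuum.Crystallization.Theorems.ChargedEnergyGapNegative (eStar eStar_le)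
open scoped BigOperators

/-- **Averaging the motif**: if every motif site energy of a periodic configuration `P` is `≤ 2c`,
then `e(P) = (2·#F)⁻¹ ∑_{x ∈ F} U_P(x) ≤ (2·#F)⁻¹ · (#F · 2c) = c` (`#F > 0`). [folklore] -/
theorem energyPerParticle_le_of_motif_site_le {d : ℕ} (V : ℝ → ℝ) (P : PeriodicConfiguration d)
    {c : ℝ}
    (h : ∀ x ∈ P.motif,
      ∑' y : {y : EuclideanSpace ℝ (Fin d) // y ∈ P.points ∧ y ≠ x}, V (dist x y.1) ≤ 2 * c) :
    P.energyPerParticle V ≤ c := by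
  have hcard : (0 : ℝ) < P.motif.card := by exact_mod_cast P.motif_nonempty.card_pos
  have hsum := Finset.sum_le_card_nsmul _ _ _ h
  rw [nsmul_eq_mul] at hsum
  unfold PeriodicConfiguration.energyPerParticle
  calc (2 * (P.motif.card : ℝ))⁻¹ *
        ∑ x ∈ P.motif, ∑' y : {y : EuclideanSpace ℝ (Fin d) // y ∈ P.points ∧ y ≠ x}, V (dist x y.1)
      ≤ (2 * (P.motif.card : ℝ))⁻¹ * ((P.motif.card : ℝ) * (2 * c)) :=
        mul_le_mul_of_nonneg_left hsum (by positivity)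
    _ = (2 * (P.motif.card : ℝ))⁻¹ * ((2 * (P.motif.card : ℝ)) * c) := by ring
    _ = c := inv_mul_cancel_left₀ (mul_pos two_pos hcard).ne' c

/-- **Site bound at every point gives `e(P) ≤ E*`**: if every site `p ∈ P.points` of a periodic
configuration of `ℝ³` has Lennard-Jones site energy `≤ 2E*`, then `e_LJ(P) ≤ E*` (motif points are
points, then average over the motif). [folklore] -/
theorem energyPerParticle_le_eStar_of_site_le (P : PeriodicConfiguration 3)
    (hP : ∀ p ∈ P.points, ∑' q : {q : EuclideanSpace ℝ (Fin 3) // q ∈ P.points ∧ q ≠ p},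
        lennardJones (dist p q.1) ≤ 2 * eStar) :
    P.energyPerParticle lennardJones ≤ eStar :=
  energyPerParticle_le_of_motif_site_le lennardJones P fun x hx =>
    hP x (P.mem_points_of_mem_motif hx)

/-- **Stub `stub_periodicLeast`** (crux `UniformBindingRigidity`, stmt-AtomisticToContinuum-15099,
line `registered`): a periodic configuration `P` of `ℝ³` all of whose sites are bound `≤ 2E*`,
`E* = ⨅_Q e_LJ(Q)` over periodic configurations `Q`, is a least element of the range of the
Lennard-Jones energy per particle — `e(P) ≤ E*` by averaging the motif site energies
(`energyPerParticle_le_eStar_of_site_le`), and `E* ≤ e(Q)` for every periodic `Q` since the range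
is bounded below (item 0714, `ChargedEnergyGapNegative.eStar_le`). [folklore] -/
theorem stub_periodicLeast :
    ∀ P : PeriodicConfiguration 3,
      (∀ p ∈ P.points, ∑' q : {q : EuclideanSpace ℝ (Fin 3) // q ∈ P.points ∧ q ≠ p},
          lennardJones (dist p q.1) ≤
        2 * ⨅ Q : PeriodicConfiguration 3, Q.energyPerParticle lennardJones) →
      IsLeast (Set.range fun Q : PeriodicConfiguration 3 => Q.energyPerParticle lennardJones)
        (P.energyPerParticle lennardJones) := by
  intro P hP
  have hle : P.energyPerParticle lennardJones ≤ eStar := energyPerParticle_le_eStar_of_site_le P hP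
  refine ⟨⟨P, rfl⟩, ?_⟩
  rintro _ ⟨Q, rfl⟩
  exact hle.trans (eStar_le Q)

end Summit.AtomisticToContinuum.Crystallization.Theorems.PerronTransitivityUniformBindingRigidity

end
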